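import Summits.HodgeConjecture.HodgeConjecture.Cruxes.BlochSeedDiscOne.SeedCheckerSplitBlock
import Summits.HodgeConjecture.HodgeConjecture.Cruxes.BlochSeedDiscOne.PortHallLegSurplus
import Summits.HodgeConjecture.HodgeConjecture.Cruxes.BlochSeedDiscOne.RowAlpha3HonestBudget
import Summits.HodgeConjecture.HodgeConjecture.Cruxes.BlochSeedDiscOne.PatternedPorteous
import Literature.AlgebraicGeometry.HodgeTheory.ChernCharacterBettiTwistNormalised
import Literature.AlgebraicGeometry.HodgeTheory.ChernCharacterBettiRescale

/-!
line stmt-HodgeConjecture-18881 Cruxes/BlochSeedDiscOne/Lines/birth.lean 814a6a70c14e831a stub_rung_pad4_seedAt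

# SeedCheckerSplitBlockCFree — the C5–C8 seed checker v42: the C-FREE split-block core `δ₀`, RUNG 2a₀ ∕ 2b₀, the rows of record of
R19.853, and the realisation clause OFF the path (hsemireg-c5c8-1 g54, 2026-08-31; TYPING SPEC for `Lines/splitblock.lean`, whose one writer
is the cruxplan lineage — this file registers NO stub and touches NO skeleton)

Additive over v41 `SeedCheckerSplitBlock` (`SplitBlock.*`; nothing there is renamed or restated).  Revision v42.1 (same session): the first
landing (crux commit cc642ebe6ffd) typed `Rung2b₀` UNGUARDED and without shell positivity; hsem-2 MEMO-177 (F6 ∕ F7, kernel: identity ∕ frame PADDING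
defeats every unguarded 2b; the C-free core does not force positive multiplicities) and director R19.858 ∕ R19.859 (row α1 per door; LAW PP on `weakB`;
leg row flagged) arrived while it was being typed — this revision carries them: SCOPE AS ANTECEDENT of every 2b, `Dsh.Positive` in every rung, the
α1 row a SLOT `RD`, the laws PER DATUM (`Rung2b₀Under Λ`).  Orders executed: director-hodge R19.845 (O1) (on-path stub C-FREE; every C-carrying
clause OFF path and NAMING item 19780), R19.847 (budget functional a PARAMETER `σ`; (8♮) `RowAlpha3.phiAll`, (8σ) `SigmaH.sigmaH` under a NAMED law),
R19.853 (supersedes R19.846 (2)(i): `EntrySharp` does NOT enter the scope; NOT PortHall₈, NOT `8 ≤ rank`), R19.855 (homonym `pairDim` — never used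
unqualified here), R19.858 (a) (cokernel orientation only: v42 declares NO K-orientation rungs; v41's `Rung2aSheafK ∕ Rung2bSheafK` are DEPRECATED,
flag C2-K, and referenced nowhere below) and (b) (ROW α1 PER DOOR: slot `RD`), R19.859 (rows 5 ∕ 6 ∕ 6′: `HallUp`, LAW PP `PPClean weakB`,
`HallPlusLegUp` flagged), R19.849 ∕ R19.850 (the sheaf door's window budget is sheaf8-1's tree leaf `SheafDoorWindowBudget.BudgetClauseW` — cited by
name, not imported: `budgetClauseW_iff : BudgetClauseW σ I₀ D ↔ RuleDPlate.BudgetClause σ (3136 − windowBudget I₀) D`, so `π` stays a parameter).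

## Dictionary (what the cruxplan seats import from here)

* §42.1 ROWS v42.  Scope (antecedent side) = v41 `ScopeRows h` UNCHANGED (`OnAlphabet h ∧ Disj`).  Shadow (conclusion side) =
  `ShadowRows₀ RD PP σ π D' := A1 ∧ μ ≠ 0 ∧ RD D' ∧ HallUp ∧ PP D' ∧ HallPlusLegUp ∧ 4 ≤ rank ∧ BudgetClause σ π` with THREE slots: the α1 row
  `RD` (line #2: `LeggedFloor.RuleD` under the law `StaticAlongTW`; sheaf door: `RuleDSharp`, hsem-3, not yet in the tree), the LAW-PP row `PP`
  (instance of record `lawPP := PatternedPorteous.PPClean PatternedPorteous.weakB`) and the budget functional `σ` with rider `π`.  The closed-room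
  statement in this currency is `SPlus₀ RD PP h σ π := ∀ D', ¬ (ScopeRows h D' ∧ ShadowRows₀ RD PP σ π D')` — a HYPOTHESIS of the kill theorems, as
  `RuleDPlate.SPlus` was in v41; by R19.853 only shells 1–2 are closed in this room today, shells 3–4 OPEN.  `sPlus_of_sPlus₀`: the v42 closure with
  `RD := RuleD` implies the v41 closure (given PP and the floor from the v41 rows), not conversely.
* §42.2 THE C-FREE CORE.  `LetterKit₀ E₀ s` (bundles + rank ≤ 1, NO `realises`), `BlockTerm₀` (v41 `BlockTerm` minus `hasCh`, kit C-free),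
  `SplitBlockCore₀ E₀ ψ₀` (anchor kit, linked word frame, shell design, the block `0 → 𝓟 → 𝓝 → 𝓔 → 0` — COKERNEL orientation, R19.858 (a) — with
  both terms split) and its `entry P c N c' : L_P ⟶ L_N`.  C-free ENTRY LAWS the pen rows read (answer to R19.846 (O4): the letters ARE readable
  C-free — as laws on the NAMED summands `δ₀.termP.kit.L P`, `δ₀.termN.kit.L N` and the entries between them): `LetterHomVanishing₀ δ₀` (Hom
  zero-pattern governed by `WeakLive` of the shadows), `DeadEntriesVanish δ₀`; v41's C-parametric `LetterHomVanishing C Φ` DELIVERS the C-free law on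
  any realised core (`letterHomVanishing₀_of_letterHomVanishing`).  OFF PATH: `SplitBlockCore₀.LettersRealise C`, bridges `toSplitBlockCore` ∕
  `SplitBlockCore.toCore₀`.  POSITIVITY (MEMO-177 F7): the C-free core ties the shell's multiplicities to the sheaf only through `Fin (m Z).toNat`, so
  `Dsh.Positive` is demanded EXPLICITLY by every rung below (a conjunct of 2a, an antecedent of 2b).
* §42.3 THE C-FREE DATUM `SplitBlockDatum₀ E₀ ψ₀` (core + frame `0 → 𝒪^k → 𝓔 → Q → 0`, `rank Q = 4`, section, presented subscheme; v41's
  `realisesFrame` moved off path into `Realises C := LettersRealise C ∧ frame realises k·ch(𝒪)`).  `Passes` (∃ q, SeedCheck ∧ zero scheme) and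
  `PassesLaw` (ClassData ∧ zero scheme ∧ regular immersion of codim 4 ∧ integral ∧ Bloch-semiregular) are C-FREE VERBATIM; the door-Z discharge
  `passes_of_passesLaw₀` takes `(C, TopChernFourLocalisation C, δ₀.Realises C)` — C enters ONLY there.  `Passes.blochSeedDiscOne₀`: a passing
  C-free datum on a CM anchor gives the crux BY NAME.  Bridges `toSplitBlockDatum` ∕ `SplitBlockDatum.toDatum₀` (`Passes` agree by `Iff.rfl`).
* §42.4 THE REALISATION CLAUSE, three typings, all OFF path: (R1) `RealisationClause N δ₀ := ∀ C, N C → δ₀.Realises C` over a GUARD `N` (the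
  director's shape, R19.845 (1)); (R2) `RealisesUpToScale δ₀ := ∀ C, ∃ t ≠ 0, δ₀.Realises (C.rescale t _)` (the scale-covariant shape the tree's
  `ChernCharacterBettiRescale` docstring prescribes for `∀ C` consumers); (R3) `Realisable δ₀ := ∃ C, TopChernFourLocalisation C ∧ δ₀.Realises C`
  (existential — this IS item 19780's `Nonempty ChernCharacterBetti` plus data: `Realisable.nonempty`; `Lines/splitblock.md` must NAME 19780
  (`Ring2.SemiregularRepresentatives.ChernCharacterOnBetti`) for it).  **HAZARD (f5), kernel-checked here**: the guard `N := IsTwistNormalised` is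
  CLOSED under `C ↦ C.rescale 2` (`isTwistNormalised_rescale_two`: the hyperplane class is READ THROUGH `C`, so it doubles along with `ch₁`), and for
  ANY rescale-closed guard inhabited by one `C₀` the clause (R1) forces EVERY positive-degree letter class of `δ₀` to vanish
  (`classOf_eq_zero_of_realisationClause`; instance `classOf_eq_zero_of_twistNormalisedClause`).  So (R1) needs a guard that PINS THE SCALE —
  candidates NOT typed here: agreement of `C.ch₁` with the topological first Chern class `Modules.detTopChernClass` (needs
  `ParacompactSpace (ComplexPoints X)`, absent from the tree), or a C-free hyperplane class; until then (R2) ∕ (R3) are the honest clauses.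
* §42.5 RUNGS.  ON PATH: `Rung2a₀ h := ∃ CM anchor, ∃ δ₀ : SplitBlockDatum₀, δ₀.Dsh.Positive ∧ δ₀.Passes ∧ ScopeRows h δ₀.Dsh.shadow` — C-FREE
  like `stub_rung_pad4_seedAt` — with `blochSeedDiscOne_of_rung2a₀ : Rung2a₀ h → …Theses.EightfoldBlochSeeds.BlochSeedDiscOne` PROVED (the
  skeleton's `BlochSeedDiscOne_of`).  OFF PATH, the pen's target shape: `Rung2b₀Under Λ h Rows := ∀ anchors δ₀, Λ δ₀ → δ₀.Dsh.Positive → δ₀.Passes →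
  ScopeRows h δ₀.Dsh.shadow → Rows δ₀.Dsh.shadow` (law `Λ : DatumLaw` PER DATUM; SCOPE AS ANTECEDENT — MEMO-177 F6; rows parametric), law-free
  `Rung2b₀With h Rows`, of record `Rung2b₀ RD PP h σ π`, line #2 instance `Rung2b₀Lci Λ σ π := Rung2b₀Under Λ 14 (ShadowRows₀ RuleD lawPP σ π)`
  ((8♮) `σ := RowAlpha3.phiAll, π := 0, Λ := StaticAlongTW`; (8σ) `σ := SigmaH.sigmaH` with `Λ := StaticAlongTW ∧ KunnethNoInterference` — law
  decls owed by semihom-1 ∕ dual).  KILLS: `not_rung2a₀Under_of_rung2b₀Under` (rows closed on the scope ⟹ no law-abiding positive passing in-scope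
  datum), `not_rung2a₀_of_rung2b₀Under` (law valid for all data ⟹ ¬ 2a₀), `not_rung2a₀_of_rung2b₀With`, `not_rung2a₀_of_rung2b₀_of_sPlus₀`,
  `not_rung2a₀Under_of_rung2b₀Lci`.  A closed room retires the (law-restricted) split-block ANSATZ at that height in that row currency — never the crux.
* §42.6 DOOR S (fuse (C), `Lines/sheafdoor.lean`, № 3′ = stmt-30548), over v41's C-core: `Rung2aSheaf₀ C I h` (positive shell; implies v41
  `Rung2aSheaf C I h`, so `RBDoorChainSheafCruxSplitBlock.sheafSeedGaussSq_of_rung2aSheaf_four` composes in one line), `Rung2bSheaf₀Under C Λ I h Rows` ∕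
  `Rung2bSheaf₀With` (scope-guarded, positive, rows parametric — of record `ShadowRows₀ RuleDSharp lawPP σ (3136 − windowBudget I₀)`), kills
  `not_rung2aSheaf₀_of_rung2bSheaf₀With` ∕ `…Under` ∕ `not_rung2aSheaf₀_of_sPlus₀`; and the SCALE-COVARIANT shape `Rung2aSheafUpToScale I h :=
  ∀ C, ∃ t ≠ 0, Rung2aSheaf₀ (C.rescale t _) I h` — HAZARD (f5′): a `∀ C` stub at FIXED height (`∀ C, Rung2aSheaf C {4} 14`) quantifies over every
  rescaling of the theory while the letters' height is pinned by the TRUE classes of the linked frame (`links`), so it asserts honest blocks whose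
  true designs are the height-14 letters DIVIDED by every `t ∈ ℚˣ` — not plausibly true as typed; quantify the scale inside (`∃ t`) or pin it (§42.4).

HONEST STATUS.  Structures are DATA nobody has constructed; every `Prop` is stated, not asserted; every theorem is an implication, an unfolding or
(§42.4) linear algebra over the fields of `ChernCharacterBetti`.  Typed files + evidence, not rungs: NOTHING here is proved toward HC ∕ HC_CM ∕
HC_AV ∕ №4 ∕ 26512 ∕ 18881 ∕ 18880 ∕ 27388 ∕ 30548 ∕ H2; `stub_rung_pad4_seedAt` and `Lines/*` untouched; letters ≠ sheaves ≠ SEED; typed ≠ proved.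
No `sorry`, no new axiom, no `instance`, no notation.
-/

set_option linter.dupNamespace false
set_option autoImplicit false

open CategoryTheory AlgebraicGeometry
open Literature.AlgebraicGeometry Literature.AlgebraicGeometry.Motives Literature.AlgebraicGeometry.HodgeTheory
open Literature.AlgebraicTopology.SingularHomology

noncomputable section

namespace Summit.HodgeConjecture.HodgeConjecture.Cruxes.BlochSeedDiscOne.SeedChecker

open Summit.HodgeConjecture.HodgeConjecture.Cruxes.BlochSeedDiscOne.Anchor
open Summit.Ventures.HSemireg Summit.Ventures.HSemireg.Pad4Tower

namespace SplitBlock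

/-! ## §42.1 The rows of record v42 (R19.853 ∕ R19.858 ∕ R19.859): α1 slot, LAW PP (`weakB`), leg row, Chern floor, budget `σ` -/

section RowsV42

/-- LAW PP, the instance of record of the `PP` row (R19.859 row 6): `PatternedPorteous.PPClean` for the WEAK arrow relation `weakB` (Whitney per
closed receiver set; necessary for ANY maps with that zero pattern; kernel-decidable per design).  A default value for the PARAMETER `PP`. -/
def lawPP (D' : DepthBoundA4.Design) : Prop := PatternedPorteous.PPClean PatternedPorteous.weakB D'

/-- **SHADOW ROWS v42** (the 2b side; R19.853 as amended by R19.858 (b) and R19.859): (A1)-clean (tree form), `μ ≠ 0`, ROW α1 in the slot `RD`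
(PER DOOR, R19.858 (b): lci door ∕ line #2 `RD := LeggedFloor.RuleD` as a LAW-ROW under the named C-free law `StaticAlongTW` — see `Rung2b₀Under`;
sheaf door `RD := RuleDSharp` of hsem-3's `RowAlpha1RuleDSharp.lean` ac4881c9b4d86bc5, pen-derived — not yet in the tree, hence a parameter),
Hall [row 5, `HallB136.HallUp`], LAW PP [row 6, parameter `PP`, instance `lawPP`], the LEG row [row 6′, `PortHallLeg.HallPlusLegUp`, FLAGGED
R19.859: theorem-grade on uniform-leg and leg-free-star column sets, conditional on Q1 elsewhere], the CHERN FLOOR `4 ≤ rank`, and the budget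
`σ D' + 28·(rank − 4) + π ≤ 3136` [row 8, functional `σ` a PARAMETER, R19.847: (8♮) `RowAlpha3.phiAll`, (8σ) `SigmaH.sigmaH` under the named
law; the homonym `pairDim` (R19.855) never occurs here — `SigmaH.sigmaH` and `PortHallLeg.HallPlusLegUp` are cited fully qualified].
NOT PortHall₈, NOT `8 ≤ rank`, NOT `EntrySharp`; the SCOPE clauses (`OnAlphabet h`, `Disj`) are never conclusions (hsem-2 MEMO-177 (2)). -/
def ShadowRows₀ (RD PP : DepthBoundA4.Design → Prop) (σ : DepthBoundA4.Design → ℤ) (π : ℤ) (D' : DepthBoundA4.Design) : Prop :=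
  D'.A1 ∧ D'.mu ≠ 0 ∧ RD D' ∧ HallB136.HallUp D' ∧ PP D' ∧ PortHallLeg.HallPlusLegUp D' ∧ 4 ≤ D'.rank ∧ RuleDPlate.BudgetClause σ π D'

/-- the v42 sieve rows = v41 scope rows (UNCHANGED: `OnAlphabet h ∧ Disj`; `EntrySharp` withdrawn by R19.853) ∧ the v42 shadow rows. -/
def SieveRows₀ (RD PP : DepthBoundA4.Design → Prop) (h : ℤ) (σ : DepthBoundA4.Design → ℤ) (π : ℤ) (D' : DepthBoundA4.Design) : Prop :=
  ScopeRows h D' ∧ ShadowRows₀ RD PP σ π D'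

/-- **THE CLOSED ROOM in the v42 currency**: no letter design passes the v42 sieve rows.  A HYPOTHESIS of the kill theorem — NOT asserted: by
R19.853 shells 1–2 of this room are closed (`ShellLedger.ring1_mu_eq_zero_allHeights`, `PortHallPriceList.ring2_door_shut_of_rankFloor`), shells
3–4 are OPEN (window `Σ_P m ∈ [51, 54]`), caps `(58, 54, 112)`; R19.859's accounting rule prices any future closure by the row it uses. -/
def SPlus₀ (RD PP : DepthBoundA4.Design → Prop) (h : ℤ) (σ : DepthBoundA4.Design → ℤ) (π : ℤ) : Prop :=
  ∀ D' : DepthBoundA4.Design, ¬ SieveRows₀ RD PP h σ π D'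

/-- the v41 shadow rows (with PortHall₈) imply the v42 shadow rows with `RD := RuleD`, given the PP row and the Chern floor: PortHall₈ ⟹ the leg
row (`PortHallLeg.hallPlusLegUp_of_hallPlusUp_eight`).  (PortHall₈ gives `8 ≤ rank` only when `Σ_P m > 0`, `ShadowRows.eight_le_rank`; the
floor is therefore a separate hypothesis.) -/
theorem shadowRows₀_of_shadowRows {PP : DepthBoundA4.Design → Prop} {σ : DepthBoundA4.Design → ℤ} {π : ℤ} {D' : DepthBoundA4.Design}
    (hr : ShadowRows σ π D') (hPP : PP D') (h4 : 4 ≤ D'.rank) : ShadowRows₀ LeggedFloor.RuleD PP σ π D' := by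
  obtain ⟨h1, hd, hu, hp, hμ, hb⟩ := hr
  exact ⟨h1, hμ, hd, hu, hPP, PortHallLeg.hallPlusLegUp_of_hallPlusUp_eight D' hp, h4, hb⟩

/-- hence **the v42 closure (α1 = `RuleD`) implies the v41 closure `S⁺(h; σ, π)`** whenever the PP row and the Chern floor follow from the v41
shadow rows (hypotheses). -/
theorem sPlus_of_sPlus₀ {PP : DepthBoundA4.Design → Prop} {h : ℤ} {σ : DepthBoundA4.Design → ℤ} {π : ℤ}
    (hPP : ∀ D', ShadowRows σ π D' → PP D') (h4 : ∀ D', ShadowRows σ π D' → 4 ≤ D'.rank) (hS : SPlus₀ LeggedFloor.RuleD PP h σ π) :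
    RuleDPlate.SPlus h σ π := by
  rw [sPlus_iff_forall_not_sieveRows]
  rintro D' ⟨hscope, hshadow⟩
  exact hS D' ⟨hscope, shadowRows₀_of_shadowRows hshadow (hPP D' hshadow) (h4 D' hshadow)⟩

/-- monotonicity of the v42 shadow rows in the budget functional (`RowAlpha3.budgetClause_of_le`: a SMALLER functional is a WEAKER row). -/
theorem shadowRows₀_mono_budget {RD PP : DepthBoundA4.Design → Prop} {Φ σ : DepthBoundA4.Design → ℤ} (hle : ∀ D, Φ D ≤ σ D) {π : ℤ}
    {D' : DepthBoundA4.Design} (hr : ShadowRows₀ RD PP σ π D') : ShadowRows₀ RD PP Φ π D' := by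
  obtain ⟨h1, hμ, hd, hu, hp, hl, hk, hb⟩ := hr
  exact ⟨h1, hμ, hd, hu, hp, hl, hk, RowAlpha3.budgetClause_of_le hle π D' hb⟩

/-- monotonicity in the α1 slot (`RuleDSharp → RuleD` makes the sharp rows imply the plain rows). -/
theorem shadowRows₀_mono_alpha1 {RD RD' PP : DepthBoundA4.Design → Prop} (hle : ∀ D, RD D → RD' D) {σ : DepthBoundA4.Design → ℤ} {π : ℤ}
    {D' : DepthBoundA4.Design} (hr : ShadowRows₀ RD PP σ π D') : ShadowRows₀ RD' PP σ π D' := by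
  obtain ⟨h1, hμ, hd, hu, hp, hl, hk, hb⟩ := hr
  exact ⟨h1, hμ, hle _ hd, hu, hp, hl, hk, hb⟩

end RowsV42

/-! ## §42.2 The C-free core: letter kit, split terms, the block; C-free entry laws; realisation OFF the path -/

section CoreCFree

variable {E₀ : AbelianVariety ℂ} {ψ₀ : E₀ ⟶ E₀}

/-- **THE C-FREE LETTER KIT on the cells `s`**: for each cell a module of rank `≤ 1` on the pad4 anchor variety — the letter line bundle
`L_Z` (intended `⊠_f L(Z_f)`), WITHOUT the modelling sentence `ch(L_Z) = ch(Z)` (that sentence needs a Chern character theory and lives in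
`LetterKit₀.Realises`). -/
structure LetterKit₀ (E₀ : AbelianVariety ℂ) (s : Finset MCell) where
  /-- the letter bundles -/
  L : MCell → (pad4Anchor E₀).X.left.Modules
  rankLEOne : ∀ Z ∈ s, HasRankLE (L Z) 1

namespace LetterKit₀

variable {s : Finset MCell}

/-- OFF PATH: the kit's letters realise their cells through `(C, Φ)`. -/
def Realises (k : LetterKit₀ E₀ s) (C : ChernCharacterBetti) (Φ : WordFrame E₀) : Prop :=
  ∀ Z ∈ s, RealisesTensor C Φ (k.L Z) Z.ch

/-- a realised C-free kit is a v41 letter kit. -/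
def toLetterKit (k : LetterKit₀ E₀ s) {C : ChernCharacterBetti} {Φ : WordFrame E₀} (h : k.Realises C Φ) : LetterKit C Φ s :=
  ⟨k.L, k.rankLEOne, h⟩

theorem isVectorBundle (k : LetterKit₀ E₀ s) {Z : MCell} (hZ : Z ∈ s) : IsVectorBundle (k.L Z) :=
  (k.rankLEOne Z hZ).isVectorBundle

end LetterKit₀

/-- forgetting the modelling sentence of a v41 letter kit. -/
def _root_.Summit.HodgeConjecture.HodgeConjecture.Cruxes.BlochSeedDiscOne.SeedChecker.LetterKit.toLetterKit₀ {C : ChernCharacterBetti}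
    {Φ : WordFrame E₀} {s : Finset MCell} (k : LetterKit C Φ s) : LetterKit₀ E₀ s :=
  ⟨k.L, k.rankLEOne⟩

theorem _root_.Summit.HodgeConjecture.HodgeConjecture.Cruxes.BlochSeedDiscOne.SeedChecker.LetterKit.realises_toLetterKit₀
    {C : ChernCharacterBetti} {Φ : WordFrame E₀} {s : Finset MCell} (k : LetterKit C Φ s) : k.toLetterKit₀.Realises C Φ :=
  k.realises

/-- **A C-FREE SPLIT TERM**: `𝓝 = ⊕_{Z ∈ s} L_Z^{⊕ m_Z}` recorded as injections ∕ projections indexed by (cell, copy) with the biproduct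
equations (v41 `BlockTerm` minus the Chern-character bookkeeping `hasCh`, which needs `C`). -/
structure BlockTerm₀ (E₀ : AbelianVariety ℂ) (s : Finset MCell) (m : MCell → ℤ) (𝓝 : (pad4Anchor E₀).X.left.Modules) where
  /-- the letter line bundles on the cells of `s` -/
  kit : LetterKit₀ E₀ s
  /-- the `c`-th copy of `L_Z` into `𝓝` -/
  inj : ∀ Z : ↥s, Fin (m Z).toNat → (kit.L Z ⟶ 𝓝)
  /-- the projection of `𝓝` onto the `c`-th copy of `L_Z` -/
  proj : ∀ Z : ↥s, Fin (m Z).toNat → (𝓝 ⟶ kit.L Z)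
  proj_inj_self : ∀ (Z : ↥s) (c : Fin (m Z).toNat), inj Z c ≫ proj Z c = 𝟙 (kit.L Z)
  proj_inj_ne : ∀ (Z : ↥s) (c : Fin (m Z).toNat) (Z' : ↥s) (c' : Fin (m Z').toNat),
    (⟨Z, c⟩ : Σ Z : ↥s, Fin (m Z).toNat) ≠ ⟨Z', c'⟩ → inj Z c ≫ proj Z' c' = 0
  total : ∑ Z : ↥s, ∑ c : Fin (m Z).toNat, proj Z c ≫ inj Z c = 𝟙 𝓝

namespace BlockTerm₀

variable {s : Finset MCell} {m : MCell → ℤ} {𝓝 : (pad4Anchor E₀).X.left.Modules}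

/-- OFF PATH: the term's kit realises its cells and `ch(𝓝) = Σ m_Z ch(L_Z)` through `C`. -/
def Realises (T : BlockTerm₀ E₀ s m 𝓝) (C : ChernCharacterBetti) (Φ : WordFrame E₀) : Prop :=
  T.kit.Realises C Φ ∧ HasChOfLetters C 𝓝 s m T.kit.L

/-- a realised C-free split term is a v41 split term. -/
def toBlockTerm (T : BlockTerm₀ E₀ s m 𝓝) {C : ChernCharacterBetti} {Φ : WordFrame E₀} (h : T.Realises C Φ) : BlockTerm C Φ s m 𝓝 where
  kit := T.kit.toLetterKit h.1
  inj := T.inj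
  proj := T.proj
  proj_inj_self := T.proj_inj_self
  proj_inj_ne := T.proj_inj_ne
  total := T.total
  hasCh := h.2

end BlockTerm₀

/-- forgetting the Chern-character bookkeeping of a v41 split term. -/
def _root_.Summit.HodgeConjecture.HodgeConjecture.Cruxes.BlochSeedDiscOne.SeedChecker.SplitBlock.BlockTerm.toBlockTerm₀
    {C : ChernCharacterBetti} {Φ : WordFrame E₀} {s : Finset MCell} {m : MCell → ℤ} {𝓝 : (pad4Anchor E₀).X.left.Modules}
    (T : BlockTerm C Φ s m 𝓝) : BlockTerm₀ E₀ s m 𝓝 :=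
  ⟨T.kit.toLetterKit₀, T.inj, T.proj, T.proj_inj_self, T.proj_inj_ne, T.total⟩

theorem _root_.Summit.HodgeConjecture.HodgeConjecture.Cruxes.BlochSeedDiscOne.SeedChecker.SplitBlock.BlockTerm.realises_toBlockTerm₀
    {C : ChernCharacterBetti} {Φ : WordFrame E₀} {s : Finset MCell} {m : MCell → ℤ} {𝓝 : (pad4Anchor E₀).X.left.Modules}
    (T : BlockTerm C Φ s m 𝓝) : T.toBlockTerm₀.Realises C Φ :=
  ⟨T.kit.realises, T.hasCh⟩

/-- **THE C-FREE SPLIT-BLOCK CORE on the anchor `(E₀, ψ₀)`** (R19.845 (O1) `δ₀`): the anchor kit + a linked word frame; the SHELL design `Dsh`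
(json); the block `S = (0 → 𝓟 → 𝓝 → 𝓔 → 0)` with BOTH terms split into the letter bundles of `Dsh`'s cells — and NO Chern character theory.
DATA — nothing asserts that one exists. -/
structure SplitBlockCore₀ (E₀ : AbelianVariety ℂ) (ψ₀ : E₀ ⟶ E₀) where
  /-- (pad4)(ii)–(iv): the anchor kit (C-free) -/
  K : AnchorKit E₀ ψ₀
  /-- O-WF: a word frame linked to `(h_std, r₁, r₂)` (C-free: the TRUE classes) -/
  Φ : WordFrame E₀
  links : Φ.LinksTo K.F (hStd E₀ K.η)
  /-- the SHELL design (json) -/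
  Dsh : Design
  /-- the block `0 → 𝓟 → 𝓝 → 𝓔 → 0` -/
  S : ShortComplex (pad4Anchor E₀).X.left.Modules
  shortExact : S.ShortExact
  isVectorBundle₁ : IsVectorBundle S.X₁
  isVectorBundle₃ : IsVectorBundle S.X₃
  /-- `𝓟 = ⊕_P L_P^{m_P}` -/
  termP : BlockTerm₀ E₀ Dsh.cfg.upper Dsh.mP S.X₁
  /-- `𝓝 = ⊕_N L_N^{m_N}` -/
  termN : BlockTerm₀ E₀ Dsh.cfg.lower Dsh.mN S.X₂

namespace SplitBlockCore₀

variable (δ : SplitBlockCore₀ E₀ ψ₀)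

/-- the word kit `(K, Φ, links)` (v3 `WordKit`; C-free). -/
def wordKit : WordKit E₀ ψ₀ := ⟨δ.K, δ.Φ, δ.links⟩

/-- the `(P, c) → (N, c')` MATRIX ENTRY `L_P → L_N` of the block map — C-FREE: what the pen rows α1 (RULE D), 5 (Hall), 6 (leg row) read. -/
def entry (P : ↥δ.Dsh.cfg.upper) (c : Fin (δ.Dsh.mP P).toNat) (N : ↥δ.Dsh.cfg.lower) (c' : Fin (δ.Dsh.mN N).toNat) :
    δ.termP.kit.L P ⟶ δ.termN.kit.L N :=
  δ.termP.inj P c ≫ δ.S.f ≫ δ.termN.proj N c'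

/-- **LETTER-HOM VANISHING, C-FREE form on the NAMED SUMMANDS** (the law the pen rows need, R19.845: «Hom zero-patterns of named summands»): for a
`P`-cell and an `N`-cell of the shell design whose shadows are NOT weakly live, every morphism between THEIR letter bundles in the core is zero.
A `Prop`, consumed as a hypothesis (pen: Künneth of `H⁰` of the factor differences, dead difference ⟹ `H⁰ = 0`). -/
def LetterHomVanishing₀ : Prop :=
  ∀ (P : ↥δ.Dsh.cfg.upper) (N : ↥δ.Dsh.cfg.lower), ¬ DepthBoundA4.WeakLive (shadowCell (P : MCell)) (shadowCell (N : MCell)) →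
    ∀ f : δ.termP.kit.L P ⟶ δ.termN.kit.L N, f = 0

/-- **DEAD ENTRIES VANISH** (the zero pattern of the block matrix is governed by `WeakLive` of the shadows) — C-FREE. -/
def DeadEntriesVanish : Prop :=
  ∀ (P : ↥δ.Dsh.cfg.upper) (c : Fin (δ.Dsh.mP P).toNat) (N : ↥δ.Dsh.cfg.lower) (c' : Fin (δ.Dsh.mN N).toNat),
    ¬ DepthBoundA4.WeakLive (shadowCell (P : MCell)) (shadowCell (N : MCell)) → δ.entry P c N c' = 0

theorem deadEntriesVanish_of_letterHomVanishing₀ (h : δ.LetterHomVanishing₀) : δ.DeadEntriesVanish :=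
  fun P c N c' hw => h P N hw (δ.entry P c N c')

/-- OFF PATH (R19.845 (1)): **the core's letters are realised through `C`** — both kits realise their cells in the frame and `ch(𝓟)`, `ch(𝓝)` are
the letter sums.  The ONLY place a Chern character theory touches the core. -/
def LettersRealise (C : ChernCharacterBetti) : Prop :=
  δ.termP.Realises C δ.Φ ∧ δ.termN.Realises C δ.Φ

/-- the v41 C-parametric law delivers the C-free law on every core realised through `C`. -/
theorem letterHomVanishing₀_of_letterHomVanishing {C : ChernCharacterBetti} (hR : δ.LettersRealise C) (H : LetterHomVanishing C δ.Φ) :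
    δ.LetterHomVanishing₀ :=
  fun P N hw f => H P N (δ.termP.kit.L P) (δ.termN.kit.L N) (δ.termP.kit.rankLEOne P P.2) (δ.termN.kit.rankLEOne N N.2)
    (hR.1.1 P P.2) (hR.2.1 N N.2) hw f

/-- BRIDGE: a C-free core whose letters are realised through `C` is a v41 core through `C` (same kit, frame, design, block). -/
def toSplitBlockCore (C : ChernCharacterBetti) (h : δ.LettersRealise C) : SplitBlockCore C E₀ ψ₀ where
  K := δ.K
  Φ := δ.Φ
  links := δ.links
  Dsh := δ.Dsh
  S := δ.S
  shortExact := δ.shortExact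
  isVectorBundle₁ := δ.isVectorBundle₁
  isVectorBundle₃ := δ.isVectorBundle₃
  termP := δ.termP.toBlockTerm h.1
  termN := δ.termN.toBlockTerm h.2

theorem toSplitBlockCore_Dsh (C : ChernCharacterBetti) (h : δ.LettersRealise C) : (δ.toSplitBlockCore C h).Dsh = δ.Dsh := rfl

/-- DOOR S on the C-free core, through `C` (the sheaf door reads `ch` through a theory by construction: `SheafSeedCheckRankFree C …`). -/
def PassesSheafVia (C : ChernCharacterBetti) (h : δ.LettersRealise C) (I : Finset ℕ) : Prop := (δ.toSplitBlockCore C h).PassesSheaf I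

end SplitBlockCore₀

/-- forgetting the realisation data of a v41 core. -/
def SplitBlockCore.toCore₀ {C : ChernCharacterBetti} (δ : SplitBlockCore C E₀ ψ₀) : SplitBlockCore₀ E₀ ψ₀ where
  K := δ.K
  Φ := δ.Φ
  links := δ.links
  Dsh := δ.Dsh
  S := δ.S
  shortExact := δ.shortExact
  isVectorBundle₁ := δ.isVectorBundle₁
  isVectorBundle₃ := δ.isVectorBundle₃
  termP := δ.termP.toBlockTerm₀
  termN := δ.termN.toBlockTerm₀

theorem SplitBlockCore.lettersRealise_toCore₀ {C : ChernCharacterBetti} (δ : SplitBlockCore C E₀ ψ₀) : δ.toCore₀.LettersRealise C :=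
  ⟨δ.termP.realises_toBlockTerm₀, δ.termN.realises_toBlockTerm₀⟩

theorem SplitBlockCore.toCore₀_Dsh {C : ChernCharacterBetti} (δ : SplitBlockCore C E₀ ψ₀) : δ.toCore₀.Dsh = δ.Dsh := rfl

end CoreCFree

/-! ## §42.3 The C-free split-block datum (door Z, zero-scheme reading): `Passes` ∕ `PassesLaw` C-free; `Realises C` off path -/

section DatumCFree

variable {E₀ : AbelianVariety ℂ} {ψ₀ : E₀ ⟶ E₀}

/-- **THE C-FREE SPLIT-BLOCK DATUM** (R19.845 (O1) `δ₀` for door Z): the C-free core + the frame `S' = (0 → 𝒪^k → 𝓔 → Q → 0)` with `Q` of rank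
`4`; a section of `Q`; the presented subscheme.  v41's field `realisesFrame` (a C-sentence) is moved into `Realises`.  DATA — nothing asserts one exists. -/
structure SplitBlockDatum₀ (E₀ : AbelianVariety ℂ) (ψ₀ : E₀ ⟶ E₀) extends SplitBlockCore₀ E₀ ψ₀ where
  /-- the frame size `k = rank 𝓔 − 4` -/
  k : ℕ
  /-- the frame `0 → 𝒪^k → 𝓔 → Q → 0` -/
  S' : ShortComplex (pad4Anchor E₀).X.left.Modules
  shortExact' : S'.ShortExact
  /-- its middle term is the block's cokernel -/
  mid : S.X₃ ≅ S'.X₂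
  /-- its left term is free of rank `k` -/
  frameIso : S'.X₁ ≅ SheafOfModules.free (R := (pad4Anchor E₀).X.left.ringCatSheaf) (Fin k)
  isVectorBundle₁' : IsVectorBundle S'.X₁
  /-- the quotient `Q` has constant rank `4` (C5, bundle half) -/
  rank4 : HasRank S'.X₃ 4
  /-- the section of `Q` whose zero scheme is the seed -/
  s : Modules.unitModule (pad4Anchor E₀).X.left ⟶ S'.X₃
  /-- the presented subscheme -/
  Z : Scheme.{0}
  i : Z ⟶ (pad4Anchor E₀).X.left

namespace SplitBlockDatum₀

variable (δ : SplitBlockDatum₀ E₀ ψ₀)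

/-- the rank-`4` CLASS design the checker reads (`Dsh.padApexUp 0 k`). -/
def classDesign : Design := δ.Dsh.padApexUp 0 δ.k

/-- **THE C-FREE DATUM PASSES** (law-free form, C-FREE): the class design passes the SEED CHECKER on the presented subscheme for some coefficient
`q`, and the presented subscheme IS the zero scheme of the section. -/
def Passes : Prop :=
  (∃ q : ℚ, δ.classDesign.SeedCheck δ.K δ.i q) ∧ IsZeroSchemeOf δ.s δ.i

/-- **THE C-FREE DATUM PASSES, law-carrying form** (C-FREE): C0 of the class design, the zero scheme, C5 bundle ∕ immersion, C6, C7; NO (σ). -/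
def PassesLaw : Prop :=
  δ.classDesign.ClassData ∧ IsZeroSchemeOf δ.s δ.i ∧ IsRegularImmersionOfCodim δ.i 4 ∧ AlgebraicGeometry.IsIntegral δ.Z ∧
    IsBlochSemiregular δ.i (2 * 4) 4

/-- OFF PATH: **the datum is realised through `C`** — its letters (core) and its frame (`𝒪^k` realises `k` trivial cells). -/
def Realises (C : ChernCharacterBetti) : Prop :=
  δ.toSplitBlockCore₀.LettersRealise C ∧ RealisesTensor C δ.Φ δ.S'.X₁ ((δ.k : ℤ) • (apexCell 0).ch)

/-- BRIDGE: a C-free datum realised through `C` is a v41 datum through `C`. -/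
def toSplitBlockDatum (C : ChernCharacterBetti) (h : δ.Realises C) : SplitBlockDatum C E₀ ψ₀ where
  toSplitBlockCore := δ.toSplitBlockCore₀.toSplitBlockCore C h.1
  k := δ.k
  S' := δ.S'
  shortExact' := δ.shortExact'
  mid := δ.mid
  frameIso := δ.frameIso
  isVectorBundle₁' := δ.isVectorBundle₁'
  realisesFrame := h.2
  rank4 := δ.rank4
  s := δ.s
  Z := δ.Z
  i := δ.i

theorem passes_toSplitBlockDatum (C : ChernCharacterBetti) (h : δ.Realises C) : (δ.toSplitBlockDatum C h).Passes ↔ δ.Passes := Iff.rfl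

theorem passesLaw_toSplitBlockDatum (C : ChernCharacterBetti) (h : δ.Realises C) : (δ.toSplitBlockDatum C h).PassesLaw ↔ δ.PassesLaw :=
  Iff.rfl

/-- **DOOR Z DISCHARGED, C entering ONLY through the law and the realisation**: GIVEN a theory `C` satisfying `TopChernFourLocalisation C` through
which the datum is realised, `PassesLaw ⟹ Passes` (v41 `SplitBlockDatum.passes_of_passesLaw` across the bridge). -/
theorem passes_of_passesLaw₀ (hE : E₀.dim = 1) (hψ : ψ₀ ≫ ψ₀ = -(1 • 𝟙 E₀)) {C : ChernCharacterBetti} (hloc : TopChernFourLocalisation C)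
    (hR : δ.Realises C) (h : δ.PassesLaw) : δ.Passes :=
  (δ.passes_toSplitBlockDatum C hR).1 ((δ.toSplitBlockDatum C hR).passes_of_passesLaw hE hψ hloc ((δ.passesLaw_toSplitBlockDatum C hR).2 h))

/-- a passing C-free datum gives the core certificate on its anchor … -/
theorem Passes.coreCert₀ (h : δ.Passes) : CoreCert E₀ ψ₀ := by
  obtain ⟨⟨q, hq⟩, _⟩ := h
  exact ⟨δ.classDesign, δ.K, δ.Z, δ.i, q, hq⟩

/-- … hence, on a CM anchor, **the crux `BlochSeedDiscOne` BY NAME** — from C-FREE data. -/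
theorem Passes.blochSeedDiscOne₀ (hE : E₀.dim = 1) (hψ : ψ₀ ≫ ψ₀ = -(1 • 𝟙 E₀)) (h : δ.Passes) :
    Summit.HodgeConjecture.HodgeConjecture.Theses.EightfoldBlochSeeds.BlochSeedDiscOne :=
  blochSeedDiscOne_of_coreCert hE hψ (Passes.coreCert₀ δ h)

/-! ### §42.4 the realisation clause, three typings (all OFF path), and HAZARD (f5) -/

/-- (R1) the director's shape (R19.845 (1)): **for every theory `C` passing the GUARD `N`, the datum is realised through `C`**.  See the hazard
below: `N` must PIN THE SCALE of `C`, else the clause is dead on arrival. -/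
def RealisationClause (N : ChernCharacterBetti → Prop) : Prop := ∀ C : ChernCharacterBetti, N C → δ.Realises C

/-- (R2) the SCALE-COVARIANT shape (`ChernCharacterBettiRescale`'s advice to `∀ C` consumers: quantify the scale inside): **every theory realises
the datum UP TO RESCALING `chᵢ ↦ tⁱ chᵢ`**. -/
def RealisesUpToScale : Prop := ∀ C : ChernCharacterBetti, ∃ (t : ℚ) (ht : t ≠ 0), δ.Realises (C.rescale t ht)

/-- (R3) the EXISTENTIAL shape: **some theory with the top-Chern-class law realises the datum** — this carries item 19780's content
(`Nonempty ChernCharacterBetti`, tree name `Ring2.SemiregularRepresentatives.ChernCharacterOnBetti`) and must be booked against it. -/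
def Realisable : Prop := ∃ C : ChernCharacterBetti, TopChernFourLocalisation C ∧ δ.Realises C

/-- (R3) names 19780: a realisable datum yields a Chern character theory on Betti cohomology. -/
theorem Realisable.nonempty (h : δ.Realisable) : Nonempty ChernCharacterBetti := by
  obtain ⟨C, -, -⟩ := h
  exact ⟨C⟩

/-- with (R3), the law-carrying door gives `Passes`. -/
theorem passes_of_passesLaw_of_realisable (hE : E₀.dim = 1) (hψ : ψ₀ ≫ ψ₀ = -(1 • 𝟙 E₀)) (hR : δ.Realisable) (h : δ.PassesLaw) : δ.Passes := by
  obtain ⟨C, hloc, hC⟩ := hR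
  exact δ.passes_of_passesLaw₀ hE hψ hloc hC h

/-- **HAZARD (f5), general form**: if the guard `N` is CLOSED under the rescaling `C ↦ C.rescale 2` and inhabited by some `C₀`, then the clause
(R1) forces EVERY positive-degree letter class of every `P`-cell of the datum to vanish (compare `C₀` with `C₀.rescale 2` on the letter bundle:
`2ᵖ · x = x`).  So a rescale-closed guard cannot carry the realisation clause of an honest datum. -/
theorem classOf_eq_zero_of_realisationClause {N : ChernCharacterBetti → Prop} (hN : ∀ C, N C → N (C.rescale 2 two_ne_zero))
    {C₀ : ChernCharacterBetti} (hC₀ : N C₀) (h : δ.RealisationClause N) {Z : MCell} (hZ : Z ∈ δ.Dsh.cfg.upper) (p : Fin 9)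
    (hp : 0 < (p : ℕ)) : δ.Φ.classOf p Z.ch = 0 := by
  have h₁ : C₀.ch (pad4Anchor E₀).X (δ.termP.kit.L Z) p = δ.Φ.classOf p Z.ch := (h C₀ hC₀).1.1.1 Z hZ p
  have h₂ : (C₀.rescale 2 two_ne_zero).ch (pad4Anchor E₀).X (δ.termP.kit.L Z) p = δ.Φ.classOf p Z.ch :=
    (h (C₀.rescale 2 two_ne_zero) (hN C₀ hC₀)).1.1.1 Z hZ p
  rw [ChernCharacterBetti.rescale_ch, h₁] at h₂
  have hne : (((2 : ℚ) ^ (p : ℕ) : ℚ) : ℂ) - 1 ≠ 0 := by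
    have h2i : (1 : ℚ) < 2 ^ (p : ℕ) := one_lt_pow₀ (by norm_num) hp.ne'
    have : (((2 : ℚ) ^ (p : ℕ) : ℚ) : ℂ) ≠ 1 := by exact_mod_cast h2i.ne'
    exact sub_ne_zero.2 this
  have hx : ((((2 : ℚ) ^ (p : ℕ) : ℚ) : ℂ) - 1) • δ.Φ.classOf p Z.ch = 0 := by rw [sub_smul, one_smul, h₂, sub_self]
  rw [← inv_smul_smul₀ hne (δ.Φ.classOf p Z.ch), hx, smul_zero]

/-- the same for the `N`-cells. -/
theorem classOf_eq_zero_of_realisationClause_lower {N : ChernCharacterBetti → Prop} (hN : ∀ C, N C → N (C.rescale 2 two_ne_zero))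
    {C₀ : ChernCharacterBetti} (hC₀ : N C₀) (h : δ.RealisationClause N) {Z : MCell} (hZ : Z ∈ δ.Dsh.cfg.lower) (p : Fin 9)
    (hp : 0 < (p : ℕ)) : δ.Φ.classOf p Z.ch = 0 := by
  have h₁ : C₀.ch (pad4Anchor E₀).X (δ.termN.kit.L Z) p = δ.Φ.classOf p Z.ch := (h C₀ hC₀).1.2.1 Z hZ p
  have h₂ : (C₀.rescale 2 two_ne_zero).ch (pad4Anchor E₀).X (δ.termN.kit.L Z) p = δ.Φ.classOf p Z.ch :=
    (h (C₀.rescale 2 two_ne_zero) (hN C₀ hC₀)).1.2.1 Z hZ p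
  rw [ChernCharacterBetti.rescale_ch, h₁] at h₂
  have hne : (((2 : ℚ) ^ (p : ℕ) : ℚ) : ℂ) - 1 ≠ 0 := by
    have h2i : (1 : ℚ) < 2 ^ (p : ℕ) := one_lt_pow₀ (by norm_num) hp.ne'
    have : (((2 : ℚ) ^ (p : ℕ) : ℚ) : ℂ) ≠ 1 := by exact_mod_cast h2i.ne'
    exact sub_ne_zero.2 this
  have hx : ((((2 : ℚ) ^ (p : ℕ) : ℚ) : ℂ) - 1) • δ.Φ.classOf p Z.ch = 0 := by rw [sub_smul, one_smul, h₂, sub_self]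
  rw [← inv_smul_smul₀ hne (δ.Φ.classOf p Z.ch), hx, smul_zero]

end SplitBlockDatum₀

/-- forgetting the realisation data of a v41 datum. -/
def SplitBlockDatum.toDatum₀ {C : ChernCharacterBetti} (δ : SplitBlockDatum C E₀ ψ₀) : SplitBlockDatum₀ E₀ ψ₀ where
  toSplitBlockCore₀ := δ.toSplitBlockCore.toCore₀
  k := δ.k
  S' := δ.S'
  shortExact' := δ.shortExact'
  mid := δ.mid
  frameIso := δ.frameIso
  isVectorBundle₁' := δ.isVectorBundle₁'
  rank4 := δ.rank4
  s := δ.s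
  Z := δ.Z
  i := δ.i

theorem SplitBlockDatum.realises_toDatum₀ {C : ChernCharacterBetti} (δ : SplitBlockDatum C E₀ ψ₀) : δ.toDatum₀.Realises C :=
  ⟨δ.toSplitBlockCore.lettersRealise_toCore₀, δ.realisesFrame⟩

theorem SplitBlockDatum.passes_toDatum₀ {C : ChernCharacterBetti} (δ : SplitBlockDatum C E₀ ψ₀) : δ.toDatum₀.Passes ↔ δ.Passes := Iff.rfl

end DatumCFree

/-! ### §42.4 (continued) HAZARD (f5) for the guard of record: `IsTwistNormalised` is closed under `C ↦ C.rescale 2` -/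

section TwistHazard

/-- the hyperplane class READ THROUGH the rescaled theory is the rescaled hyperplane class: `H_{C.rescale 2} = 2 · H_C`. -/
theorem hyperplaneClass_rescale_two (C : ChernCharacterBetti) (N : ℕ) :
    (C.rescale 2 two_ne_zero).hyperplaneClass N = (2 : ℂ) • C.hyperplaneClass N := by
  rw [ChernCharacterBetti.hyperplaneClass_def, ChernCharacterBetti.hyperplaneClass_def, ChernCharacterBetti.rescale_ch, smul_neg, pow_one,
    Rat.cast_ofNat]

/-- **`IsTwistNormalised` does NOT pin the scale**: it is preserved by `C ↦ C.rescale 2` (every clause is homogeneous in `C`, the hyperplane class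
being `-C.ch₁(𝒪(-1))`).  [linear algebra over the five clauses] -/
theorem isTwistNormalised_rescale_two {C : ChernCharacterBetti} (hC : C.IsTwistNormalised) : (C.rescale 2 two_ne_zero).IsTwistNormalised where
  isIntegralClass_hyperplaneClass N := by
    rw [hyperplaneClass_rescale_two, two_smul]
    exact (hC.isIntegralClass_hyperplaneClass N).add (hC.isIntegralClass_hyperplaneClass N)
  hyperplaneClass_ne_zero {N} hN := by
    rw [hyperplaneClass_rescale_two]
    exact smul_ne_zero two_ne_zero (hC.hyperplaneClass_ne_zero hN)
  exists_rat_smul_hyperplaneClass {N} {x} hx := by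
    obtain ⟨q, hq⟩ := hC.exists_rat_smul_hyperplaneClass hx
    refine ⟨q / 2, ?_⟩
    rw [hyperplaneClass_rescale_two, smul_smul, hq]
    congr 1
    push_cast
    ring
  ch_serreTwist_zero N X f m := by
    rw [ChernCharacterBetti.rescale_ch, hC.ch_serreTwist_zero, pow_zero, Rat.cast_one, one_smul]
  ch_serreTwist_one N X f m := by
    rw [ChernCharacterBetti.rescale_ch, hC.ch_serreTwist_one, hyperplaneClass_rescale_two, map_smul, pow_one, Rat.cast_ofNat]
    simp only [smul_neg, smul_smul, mul_comm]

variable {E₀ : AbelianVariety ℂ} {ψ₀ : E₀ ⟶ E₀}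

/-- **HAZARD (f5) for the clause of R19.845 (1) AS WORDED** («`∀ C, IsTwistNormalised C → δ₀.LettersRealise C`»): as soon as ONE twist-normalised
theory exists, the clause forces every positive-degree letter class of the datum to vanish — it cannot hold for an honest datum.  (Hence the
guard of (R1) must break rescaling; see the module docstring for the candidates.) -/
theorem SplitBlockDatum₀.classOf_eq_zero_of_twistNormalisedClause (δ : SplitBlockDatum₀ E₀ ψ₀) {C₀ : ChernCharacterBetti}
    (hC₀ : C₀.IsTwistNormalised) (h : δ.RealisationClause ChernCharacterBetti.IsTwistNormalised) {Z : MCell} (hZ : Z ∈ δ.Dsh.cfg.upper)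
    (p : Fin 9) (hp : 0 < (p : ℕ)) : δ.Φ.classOf p Z.ch = 0 :=
  δ.classOf_eq_zero_of_realisationClause (fun _ hC => isTwistNormalised_rescale_two hC) hC₀ h hZ p hp

end TwistHazard

/-! ## §42.5 RUNG 2a₀ (C-free, ON PATH) and RUNG 2b₀ (scope-GUARDED, law-guarded, rows parametric; OFF PATH); the kill paths -/

section RungsCFree

/-- **RUNG 2a₀ — the ON-PATH statement, C-FREE** (R19.845 (O1)): on SOME CM anchor a C-free split-block datum with a POSITIVE shell design
(every listed cell has multiplicity `≥ 1` — hsem-2 MEMO-177 (4) F7: the C-free core ties multiplicities to the sheaf only through `Fin m.toNat`,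
so non-positive cells would be spurious alphabet entries) PASSES, and its shell shadow is in READING-1 normal form on the height-`h` alphabet
(v41 scope rows, json-decidable).  No Chern character theory is quantified anywhere. -/
def Rung2a₀ (h : ℤ) : Prop :=
  ∃ (E₀ : AbelianVariety ℂ) (ψ₀ : E₀ ⟶ E₀) (_ : E₀.dim = 1) (_ : ψ₀ ≫ ψ₀ = -(1 • 𝟙 E₀)) (δ : SplitBlockDatum₀ E₀ ψ₀),
    δ.Dsh.Positive ∧ δ.Passes ∧ ScopeRows h δ.Dsh.shadow

/-- **RUNG 2a₀ ⟹ THE CRUX `BlochSeedDiscOne` BY NAME** (sorry-free; the skeleton's `BlochSeedDiscOne_of`, against a C-FREE stub). -/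
theorem blochSeedDiscOne_of_rung2a₀ {h : ℤ} (h2a : Rung2a₀ h) :
    Summit.HodgeConjecture.HodgeConjecture.Theses.EightfoldBlochSeeds.BlochSeedDiscOne := by
  obtain ⟨E₀, ψ₀, hE, hψ, δ, _, hδ, _⟩ := h2a
  exact SplitBlockDatum₀.Passes.blochSeedDiscOne₀ δ hE hψ hδ

/-- from the law-carrying door: a positive C-free datum with `PassesLaw`, realisable through some lawful theory, in scope, gives RUNG 2a₀. -/
theorem rung2a₀_of_passesLaw {E₀ : AbelianVariety ℂ} {ψ₀ : E₀ ⟶ E₀} (hE : E₀.dim = 1) (hψ : ψ₀ ≫ ψ₀ = -(1 • 𝟙 E₀))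
    (δ : SplitBlockDatum₀ E₀ ψ₀) (hpos : δ.Dsh.Positive) (hR : δ.Realisable) (h : δ.PassesLaw) {hgt : ℤ}
    (hscope : ScopeRows hgt δ.Dsh.shadow) : Rung2a₀ hgt :=
  ⟨E₀, ψ₀, hE, hψ, δ, hpos, δ.passes_of_passesLaw_of_realisable hE hψ hR h, hscope⟩

/-- a LAW ON DATA: a `Prop` over C-free split-block data on every anchor — the shape of the named laws the pen's rows are conditional on
(`StaticAlongTW δ₀` for ROW α1 on line #2, R19.858 (b); `KunnethNoInterference δ₀` for the σ_H budget, R19.847); both are owed by other lineages and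
are consumed here as PARAMETERS of this type. -/
abbrev DatumLaw := ∀ (E₀ : AbelianVariety ℂ) (ψ₀ : E₀ ⟶ E₀), SplitBlockDatum₀ E₀ ψ₀ → Prop

/-- the trivial law. -/
def DatumLaw.trivial : DatumLaw := fun _ _ _ => True

/-- **RUNG 2a₀ RESTRICTED TO A LAW** (the ansatz a law-conditional 2b can kill): some positive passing in-scope C-free datum SATISFYING `Λ`. -/
def Rung2a₀Under (Λ : DatumLaw) (h : ℤ) : Prop :=
  ∃ (E₀ : AbelianVariety ℂ) (ψ₀ : E₀ ⟶ E₀) (_ : E₀.dim = 1) (_ : ψ₀ ≫ ψ₀ = -(1 • 𝟙 E₀)) (δ : SplitBlockDatum₀ E₀ ψ₀),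
    Λ E₀ ψ₀ δ ∧ δ.Dsh.Positive ∧ δ.Passes ∧ ScopeRows h δ.Dsh.shadow

theorem Rung2a₀Under.rung2a₀ {Λ : DatumLaw} {h : ℤ} (h2a : Rung2a₀Under Λ h) : Rung2a₀ h := by
  obtain ⟨E₀, ψ₀, hE, hψ, δ, _, hpos, hδ, hscope⟩ := h2a
  exact ⟨E₀, ψ₀, hE, hψ, δ, hpos, hδ, hscope⟩

/-- under a law valid for ALL data, the restricted and the plain 2a₀ agree. -/
theorem rung2a₀Under_of_rung2a₀ {Λ : DatumLaw} (hΛ : ∀ E₀ ψ₀ δ, Λ E₀ ψ₀ δ) {h : ℤ} (h2a : Rung2a₀ h) : Rung2a₀Under Λ h := by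
  obtain ⟨E₀, ψ₀, hE, hψ, δ, hpos, hδ, hscope⟩ := h2a
  exact ⟨E₀, ψ₀, hE, hψ, δ, hΛ E₀ ψ₀ δ, hpos, hδ, hscope⟩

theorem rung2a₀Under_trivial_iff {h : ℤ} : Rung2a₀Under DatumLaw.trivial h ↔ Rung2a₀ h :=
  ⟨Rung2a₀Under.rung2a₀, rung2a₀Under_of_rung2a₀ fun _ _ _ => trivial⟩

/-- **RUNG 2b₀ UNDER A LAW, SCOPE-GUARDED, ROWS PARAMETRIC** (OFF PATH, the pen's target shape of record): on every CM anchor, every C-free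
split-block datum SATISFYING `Λ`, with POSITIVE shell, which PASSES, and whose shell shadow is IN SCOPE (`OnAlphabet h ∧ Disj` — the ANTECEDENT demanded
by hsem-2 MEMO-177 (2) F6: unguarded, identity padding `padBoth` and frame padding `𝓔 ⊕ 𝒪^m` defeat every row list, `not_rung2a_of_rung2b_of_padClosed`),
has a shadow passing `Rows`.  Scope clauses are antecedents, never conclusions. -/
def Rung2b₀Under (Λ : DatumLaw) (h : ℤ) (Rows : DepthBoundA4.Design → Prop) : Prop :=
  ∀ (E₀ : AbelianVariety ℂ) (ψ₀ : E₀ ⟶ E₀), E₀.dim = 1 → ψ₀ ≫ ψ₀ = -(1 • 𝟙 E₀) →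
    ∀ δ : SplitBlockDatum₀ E₀ ψ₀, Λ E₀ ψ₀ δ → δ.Dsh.Positive → δ.Passes → ScopeRows h δ.Dsh.shadow → Rows δ.Dsh.shadow

/-- **RUNG 2b₀ WITH ROWS `Rows`, law-free** (`Λ := ⊤`), scope-guarded. -/
def Rung2b₀With (h : ℤ) (Rows : DepthBoundA4.Design → Prop) : Prop := Rung2b₀Under DatumLaw.trivial h Rows

/-- **RUNG 2b₀ OF RECORD (rows v42)**, law-free: `Rows := ShadowRows₀ RD PP σ π`. -/
def Rung2b₀ (RD PP : DepthBoundA4.Design → Prop) (h : ℤ) (σ : DepthBoundA4.Design → ℤ) (π : ℤ) : Prop :=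
  Rung2b₀With h (ShadowRows₀ RD PP σ π)

theorem rung2b₀Under_mono {Λ : DatumLaw} {h : ℤ} {Rows Rows' : DepthBoundA4.Design → Prop} (hle : ∀ D', Rows D' → Rows' D')
    (h2b : Rung2b₀Under Λ h Rows) : Rung2b₀Under Λ h Rows' :=
  fun E₀ ψ₀ hE hψ δ hΛ hpos hδ hscope => hle _ (h2b E₀ ψ₀ hE hψ δ hΛ hpos hδ hscope)

/-- a STRONGER law gives a WEAKER (easier) 2b₀. -/
theorem rung2b₀Under_antitone {Λ Λ' : DatumLaw} (hle : ∀ E₀ ψ₀ δ, Λ' E₀ ψ₀ δ → Λ E₀ ψ₀ δ) {h : ℤ} {Rows : DepthBoundA4.Design → Prop}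
    (h2b : Rung2b₀Under Λ h Rows) : Rung2b₀Under Λ' h Rows :=
  fun E₀ ψ₀ hE hψ δ hΛ' hpos hδ hscope => h2b E₀ ψ₀ hE hψ δ (hle E₀ ψ₀ δ hΛ') hpos hδ hscope

theorem rung2b₀Under_of_rung2b₀With {Λ : DatumLaw} {h : ℤ} {Rows : DepthBoundA4.Design → Prop} (h2b : Rung2b₀With h Rows) :
    Rung2b₀Under Λ h Rows :=
  rung2b₀Under_antitone (fun _ _ _ _ => trivial) h2b

/-- a 2b₀ in a LARGER budget functional gives 2b₀ in a smaller one (`phiAll ≤ …`, `phiSep ≤ sigmaH`: `RowAlpha3`). -/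
theorem rung2b₀_mono_budget {RD PP : DepthBoundA4.Design → Prop} {h : ℤ} {Φ σ : DepthBoundA4.Design → ℤ} (hle : ∀ D, Φ D ≤ σ D) {π : ℤ}
    (h2b : Rung2b₀ RD PP h σ π) : Rung2b₀ RD PP h Φ π :=
  rung2b₀Under_mono (fun _ hr => shadowRows₀_mono_budget hle hr) h2b

/-- **THE KILL PATH, law-restricted and row-agnostic**: 2b₀ under `Λ` with `Rows` ∧ «no design passes scope ∧ `Rows`» ⟹ no positive passing
in-scope datum satisfies `Λ` — a closed room retires the split-block ANSATZ RESTRICTED TO THE LAW (in that row currency, at that height), not the crux. -/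
theorem not_rung2a₀Under_of_rung2b₀Under {Λ : DatumLaw} {h : ℤ} {Rows : DepthBoundA4.Design → Prop} (h2b : Rung2b₀Under Λ h Rows)
    (hclosed : ∀ D', ScopeRows h D' → Rows D' → False) : ¬ Rung2a₀Under Λ h := by
  rintro ⟨E₀, ψ₀, hE, hψ, δ, hΛ, hpos, hδ, hscope⟩
  exact hclosed _ hscope (h2b E₀ ψ₀ hE hψ δ hΛ hpos hδ hscope)

/-- … and when the law holds for ALL data (a THEOREM-grade law), the plain ansatz `Rung2a₀ h` dies. -/
theorem not_rung2a₀_of_rung2b₀Under {Λ : DatumLaw} (hΛ : ∀ E₀ ψ₀ δ, Λ E₀ ψ₀ δ) {h : ℤ} {Rows : DepthBoundA4.Design → Prop}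
    (h2b : Rung2b₀Under Λ h Rows) (hclosed : ∀ D', ScopeRows h D' → Rows D' → False) : ¬ Rung2a₀ h :=
  fun h2a => not_rung2a₀Under_of_rung2b₀Under h2b hclosed (rung2a₀Under_of_rung2a₀ hΛ h2a)

/-- **THE KILL PATH, law-free**: scope-guarded 2b₀ with `Rows` ∧ rows closed on the scope ⟹ ¬ 2a₀ (2a₀ supplies positivity and scope itself). -/
theorem not_rung2a₀_of_rung2b₀With {h : ℤ} {Rows : DepthBoundA4.Design → Prop} (h2b : Rung2b₀With h Rows)
    (hclosed : ∀ D', ScopeRows h D' → Rows D' → False) : ¬ Rung2a₀ h :=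
  not_rung2a₀_of_rung2b₀Under (fun _ _ _ => trivial) h2b hclosed

/-- **THE KILL PATH OF RECORD (v42 currency)**: `Rung2b₀ RD PP h σ π ∧ SPlus₀ RD PP h σ π ⟹ ¬ Rung2a₀ h`. -/
theorem not_rung2a₀_of_rung2b₀_of_sPlus₀ {RD PP : DepthBoundA4.Design → Prop} {h : ℤ} {σ : DepthBoundA4.Design → ℤ} {π : ℤ}
    (h2b : Rung2b₀ RD PP h σ π) (hS : SPlus₀ RD PP h σ π) : ¬ Rung2a₀ h :=
  not_rung2a₀_of_rung2b₀With h2b fun D' hscope hrows => hS D' ⟨hscope, hrows⟩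

/-- the law-restricted kill in the v42 row currency: `Rung2b₀Under Λ h (ShadowRows₀ RD PP σ π) ∧ SPlus₀ RD PP h σ π ⟹ ¬ Rung2a₀Under Λ h`. -/
theorem not_rung2a₀Under_of_sPlus₀ {Λ : DatumLaw} {RD PP : DepthBoundA4.Design → Prop} {h : ℤ} {σ : DepthBoundA4.Design → ℤ} {π : ℤ}
    (h2b : Rung2b₀Under Λ h (ShadowRows₀ RD PP σ π)) (hS : SPlus₀ RD PP h σ π) : ¬ Rung2a₀Under Λ h :=
  not_rung2a₀Under_of_rung2b₀Under h2b fun D' hscope hrows => hS D' ⟨hscope, hrows⟩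

/-- **LINE #2 (lci door, zero-scheme reading) 2b₀ OF RECORD, under its law** (R19.858 (b): ROW α1 = `RuleD` is a LAW-ROW under the named C-free law
`StaticAlongTW δ₀`; R19.847: the σ_H budget under `KunnethNoInterference δ₀`): `Λ` is the conjunction of the laws the instance needs —
(8♮) `Rung2b₀Lci StaticAlongTW RowAlpha3.phiAll 0`, (8σ) `Rung2b₀Lci (StaticAlongTW ∧ KunnethNoInterference) SigmaH.sigmaH 0` — both law decls
owed by the semihom-1 ∕ dual lineages; until they are in the tree the cruxplan seat registers the instance with `Λ` spelled as their decl names. -/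
def Rung2b₀Lci (Λ : DatumLaw) (σ : DepthBoundA4.Design → ℤ) (π : ℤ) : Prop :=
  Rung2b₀Under Λ 14 (ShadowRows₀ LeggedFloor.RuleD lawPP σ π)

/-- its kill: with the closed room in the v42 currency (α1 = `RuleD`, height 14), no law-abiding positive passing in-scope datum exists. -/
theorem not_rung2a₀Under_of_rung2b₀Lci {Λ : DatumLaw} {σ : DepthBoundA4.Design → ℤ} {π : ℤ} (h2b : Rung2b₀Lci Λ σ π)
    (hS : SPlus₀ LeggedFloor.RuleD lawPP 14 σ π) : ¬ Rung2a₀Under Λ 14 :=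
  not_rung2a₀Under_of_sPlus₀ h2b hS

/-- **RUNG 2a₀ WITH THE ROWS CARRIED** (scope-explicit variant): the certificate records that its shadow passes ALL v42 sieve rows; the closed room
kills it with no 2b₀, and scope-guarded 2b₀ is exactly what upgrades `Rung2a₀` to it. -/
def Rung2aRows₀ (RD PP : DepthBoundA4.Design → Prop) (h : ℤ) (σ : DepthBoundA4.Design → ℤ) (π : ℤ) : Prop :=
  ∃ (E₀ : AbelianVariety ℂ) (ψ₀ : E₀ ⟶ E₀) (_ : E₀.dim = 1) (_ : ψ₀ ≫ ψ₀ = -(1 • 𝟙 E₀)) (δ : SplitBlockDatum₀ E₀ ψ₀),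
    δ.Dsh.Positive ∧ δ.Passes ∧ SieveRows₀ RD PP h σ π δ.Dsh.shadow

theorem Rung2aRows₀.rung2a₀ {RD PP : DepthBoundA4.Design → Prop} {h : ℤ} {σ : DepthBoundA4.Design → ℤ} {π : ℤ}
    (h2 : Rung2aRows₀ RD PP h σ π) : Rung2a₀ h := by
  obtain ⟨E₀, ψ₀, hE, hψ, δ, hpos, hδ, hrows⟩ := h2
  exact ⟨E₀, ψ₀, hE, hψ, δ, hpos, hδ, hrows.1⟩

theorem rung2aRows₀_of_rung2a₀ {RD PP : DepthBoundA4.Design → Prop} {h : ℤ} {σ : DepthBoundA4.Design → ℤ} {π : ℤ}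
    (h2b : Rung2b₀ RD PP h σ π) (h2a : Rung2a₀ h) : Rung2aRows₀ RD PP h σ π := by
  obtain ⟨E₀, ψ₀, hE, hψ, δ, hpos, hδ, hscope⟩ := h2a
  exact ⟨E₀, ψ₀, hE, hψ, δ, hpos, hδ, hscope, h2b E₀ ψ₀ hE hψ δ trivial hpos hδ hscope⟩

theorem not_rung2aRows₀_of_sPlus₀ {RD PP : DepthBoundA4.Design → Prop} {h : ℤ} {σ : DepthBoundA4.Design → ℤ} {π : ℤ}
    (hS : SPlus₀ RD PP h σ π) : ¬ Rung2aRows₀ RD PP h σ π := by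
  rintro ⟨E₀, ψ₀, -, -, δ, -, -, hrows⟩
  exact hS _ hrows

end RungsCFree

/-! ## §42.6 Door S (fuse (C), № 3′ = stmt-30548): positive + scope-guarded sheaf rungs over v41's core, and the scale-covariant shape -/

section SheafGuarded

variable {C : ChernCharacterBetti}

/-- **RUNG 2a, SHEAF DOOR, POSITIVE SHELL** (over v41's `SplitBlockCore C` — the sheaf-seed checker reads `ch` through `C` by construction): on
some CM anchor a split-block core with POSITIVE shell design passes the rank-free sheaf-seed checker in the window `I` and its shell shadow is in
scope.  It implies v41's `Rung2aSheaf C I h`, so `RBDoorChainSheafCruxSplitBlock.sheafSeedGaussSq_of_rung2aSheaf_four` and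
`hasHyperbolicBFSheafSeedOn_of_rung2aSheaf` compose with it in one line. -/
def Rung2aSheaf₀ (C : ChernCharacterBetti) (I : Finset ℕ) (h : ℤ) : Prop :=
  ∃ (E₀ : AbelianVariety ℂ) (ψ₀ : E₀ ⟶ E₀) (_ : E₀.dim = 1) (_ : ψ₀ ≫ ψ₀ = -(1 • 𝟙 E₀)) (δ : SplitBlockCore C E₀ ψ₀),
    δ.Dsh.Positive ∧ δ.PassesSheaf I ∧ ScopeRows h δ.Dsh.shadow

theorem rung2aSheaf_of_rung2aSheaf₀ {I : Finset ℕ} {h : ℤ} (h2 : Rung2aSheaf₀ C I h) : Rung2aSheaf C I h := by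
  obtain ⟨E₀, ψ₀, hE, hψ, δ, _, hδ, hscope⟩ := h2
  exact ⟨E₀, ψ₀, hE, hψ, δ, hδ, hscope⟩

/-- door S factors through the C-free core: a C-free core realised through `C` that passes the sheaf door gives `Rung2aSheaf₀`. -/
theorem rung2aSheaf₀_of_passesSheafVia {E₀ : AbelianVariety ℂ} {ψ₀ : E₀ ⟶ E₀} (hE : E₀.dim = 1) (hψ : ψ₀ ≫ ψ₀ = -(1 • 𝟙 E₀))
    (δ : SplitBlockCore₀ E₀ ψ₀) (hR : δ.LettersRealise C) {I : Finset ℕ} (hδ : δ.PassesSheafVia C hR I) (hpos : δ.Dsh.Positive) {h : ℤ}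
    (hscope : ScopeRows h δ.Dsh.shadow) : Rung2aSheaf₀ C I h :=
  ⟨E₀, ψ₀, hE, hψ, δ.toSplitBlockCore C hR, hpos, hδ, hscope⟩

/-- a LAW ON CORES (the sheaf door's named laws, if any, are `Prop`s over the core). -/
abbrev CoreLaw (C : ChernCharacterBetti) := ∀ (E₀ : AbelianVariety ℂ) (ψ₀ : E₀ ⟶ E₀), SplitBlockCore C E₀ ψ₀ → Prop

/-- the trivial core law. -/
def CoreLaw.trivial (C : ChernCharacterBetti) : CoreLaw C := fun _ _ _ => True

/-- **RUNG 2b, SHEAF DOOR, UNDER A LAW, SCOPE-GUARDED, ROWS PARAMETRIC** (hsem-2 MEMO-177 (2): «same clause for `Rung2bSheaf`»): every law-abiding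
core with positive shell that passes the sheaf door in the window `I` AND whose shadow is in scope has a shadow passing `Rows` (of record for № 3′:
`ShadowRows₀ RuleDSharp lawPP σ π` with `π := 3136 − SheafDoorWindowBudget.windowBudget I₀`, R19.850 ∕ R19.858 (b)). -/
def Rung2bSheaf₀Under (C : ChernCharacterBetti) (Λ : CoreLaw C) (I : Finset ℕ) (h : ℤ) (Rows : DepthBoundA4.Design → Prop) : Prop :=
  ∀ (E₀ : AbelianVariety ℂ) (ψ₀ : E₀ ⟶ E₀), E₀.dim = 1 → ψ₀ ≫ ψ₀ = -(1 • 𝟙 E₀) →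
    ∀ δ : SplitBlockCore C E₀ ψ₀, Λ E₀ ψ₀ δ → δ.Dsh.Positive → δ.PassesSheaf I → ScopeRows h δ.Dsh.shadow → Rows δ.Dsh.shadow

/-- law-free sheaf 2b₀. -/
def Rung2bSheaf₀With (C : ChernCharacterBetti) (I : Finset ℕ) (h : ℤ) (Rows : DepthBoundA4.Design → Prop) : Prop :=
  Rung2bSheaf₀Under C (CoreLaw.trivial C) I h Rows

/-- v41's unguarded `Rung2bSheaf C I σ π` gives the guarded law-free sheaf 2b₀ with `RD := RuleD` (given the PP row and the floor, as in §42.1). -/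
theorem rung2bSheaf₀With_of_rung2bSheaf {I : Finset ℕ} {σ : DepthBoundA4.Design → ℤ} {π : ℤ} {PP : DepthBoundA4.Design → Prop}
    (hPP : ∀ D', ShadowRows σ π D' → PP D') (h4 : ∀ D', ShadowRows σ π D' → 4 ≤ D'.rank) (h2b : Rung2bSheaf C I σ π) {h : ℤ} :
    Rung2bSheaf₀With C I h (ShadowRows₀ LeggedFloor.RuleD PP σ π) :=
  fun E₀ ψ₀ hE hψ δ _ _ hδ _ =>
    shadowRows₀_of_shadowRows (h2b E₀ ψ₀ hE hψ δ hδ) (hPP _ (h2b E₀ ψ₀ hE hψ δ hδ)) (h4 _ (h2b E₀ ψ₀ hE hψ δ hδ))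

/-- **THE SHEAF-DOOR KILL PATH, scope-guarded**: law-free sheaf 2b₀ with `Rows` ∧ rows closed on the scope ⟹ ¬ `Rung2aSheaf₀ C I h`. -/
theorem not_rung2aSheaf₀_of_rung2bSheaf₀With {I : Finset ℕ} {h : ℤ} {Rows : DepthBoundA4.Design → Prop} (h2b : Rung2bSheaf₀With C I h Rows)
    (hclosed : ∀ D', ScopeRows h D' → Rows D' → False) : ¬ Rung2aSheaf₀ C I h := by
  rintro ⟨E₀, ψ₀, hE, hψ, δ, hpos, hδ, hscope⟩
  exact hclosed _ hscope (h2b E₀ ψ₀ hE hψ δ trivial hpos hδ hscope)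

/-- the law-restricted sheaf kill: under a law valid for all cores, the same conclusion. -/
theorem not_rung2aSheaf₀_of_rung2bSheaf₀Under {Λ : CoreLaw C} (hΛ : ∀ E₀ ψ₀ δ, Λ E₀ ψ₀ δ) {I : Finset ℕ} {h : ℤ}
    {Rows : DepthBoundA4.Design → Prop} (h2b : Rung2bSheaf₀Under C Λ I h Rows) (hclosed : ∀ D', ScopeRows h D' → Rows D' → False) :
    ¬ Rung2aSheaf₀ C I h := by
  rintro ⟨E₀, ψ₀, hE, hψ, δ, hpos, hδ, hscope⟩
  exact hclosed _ hscope (h2b E₀ ψ₀ hE hψ δ (hΛ E₀ ψ₀ δ) hpos hδ hscope)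

/-- in the v42 row currency: `Rung2bSheaf₀With C I h (ShadowRows₀ RD PP σ π) ∧ SPlus₀ RD PP h σ π ⟹ ¬ Rung2aSheaf₀ C I h`. -/
theorem not_rung2aSheaf₀_of_sPlus₀ {I : Finset ℕ} {h : ℤ} {RD PP : DepthBoundA4.Design → Prop} {σ : DepthBoundA4.Design → ℤ} {π : ℤ}
    (h2b : Rung2bSheaf₀With C I h (ShadowRows₀ RD PP σ π)) (hS : SPlus₀ RD PP h σ π) : ¬ Rung2aSheaf₀ C I h :=
  not_rung2aSheaf₀_of_rung2bSheaf₀With h2b fun D' hscope hrows => hS D' ⟨hscope, hrows⟩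

/-- **THE SCALE-COVARIANT SHAPE of a `∀ C` door-S stub** (HAZARD (f5′) avoided): every theory passes the sheaf door UP TO RESCALING
`chᵢ ↦ tⁱ chᵢ`.  A FIXED-height `∀ C` stub (`∀ C, Rung2aSheaf C {4} 14`, the hypothesis of `sheafSeedGaussSq_of_rung2aSheaf_four`) quantifies over
every rescaling `C.rescale t` of every theory while the letters' height is pinned by the TRUE classes of the linked frame — it asserts honest blocks
whose true designs are the height-14 letters divided by every `t ∈ ℚˣ`; the transfer from THIS shape to № 3′'s crux needs rescale-covariance of
`HasHyperbolicBFSheafSeedOn` (the sheaf-door seat's `stub_transfer`, not stated here). -/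
def Rung2aSheafUpToScale (I : Finset ℕ) (h : ℤ) : Prop :=
  ∀ C : ChernCharacterBetti, ∃ (t : ℚ) (ht : t ≠ 0), Rung2aSheaf₀ (C.rescale t ht) I h

end SheafGuarded

/-! ## Audit: nothing is decided here

`LetterKit₀`, `BlockTerm₀`, `SplitBlockCore₀`, `SplitBlockDatum₀` are structures (data) no one has constructed; `Rung2a₀`, `Rung2a₀Under`, `Rung2b₀Under`,
`Rung2b₀With`, `Rung2b₀`, `Rung2b₀Lci`, `Rung2aRows₀`, `Rung2aSheaf₀`, `Rung2bSheaf₀Under`, `Rung2bSheaf₀With`, `Rung2aSheafUpToScale`, `SPlus₀`,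
`ShadowRows₀`, `SieveRows₀`, `lawPP`, `LetterHomVanishing₀`, `DeadEntriesVanish`, `LettersRealise`, `Realises`, `RealisationClause`, `RealisesUpToScale`,
`Realisable`, `PassesSheafVia` are `Prop`s stated, not asserted; `TopChernFourLocalisation`, the laws `Λ` (`DatumLaw` ∕ `CoreLaw` parameters) and the
closed room `SPlus₀` enter as hypotheses.  Every theorem is an implication, an unfolding, or linear algebra over the fields of `ChernCharacterBetti` ∕
`IsTwistNormalised`.  No stub of any skeleton is registered or touched. -/

end SplitBlock

end Summit.HodgeConjecture.HodgeConjecture.Cruxes.BlochSeedDiscOne.SeedChecker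

end
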